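import Summits.CriticalPhenomena.PercolationContinuityZ3.Theorems.PercNearOneGluingNoHeavyLowerTailMajorityGluingQCertSymParts
import HarnessLib

/-!
# Part 14 of 18 of the orbit certificate of the cell `(12,7)` at `c = 157/100`: data and digest (lane prim-rate, constants-miner 1, gen 36; generated by cert/mksym.py)

Support file for the closed crux `NoHeavyLowerTail` (stmt-CriticalPhenomena-4575), majority-gluing line.  The symmetrised certificate of the cell `(12,7)`
(kit j286395, symcert.py) is checked IN PARTS (`…MajorityGluingQCertSymParts`): this file holds part 14 (1 multiplier terms, 1 marginal slacks,
0 rows, 0 squares; 3636 contributions) and its DIGEST `twelveSevenSymP14D` (62 orbit keys), verified by `decide +kernel` (`twelveSevenSymP14_digest`).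
The parts are glued in `…MajorityGluingQCertSymTwelveSeven`.  No sorries. [cite: VandenbergKahn2001, Thm 1.2 (p. 123)]
-/

namespace Summit.CriticalPhenomena.PercolationContinuityZ3.Theorems

namespace HubOnly
namespace QCert

/-- Row representatives of part 14: `(A, X, B, Y, n, masks of f(A,X), f(B,Y), f(A∪B,X∩Y), f(∅,X∪Y))`. -/
def twelveSevenSymP14Rows : List RowE :=
  []

/-- Square representatives of part 14: `(a, b, n, mask₁, mask₂)`. -/
def twelveSevenSymP14Sqs : List SqE :=
  []

/-- **Part 14** of the `(12,7)` orbit certificate at `157/100`. -/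
def twelveSevenSymP14 : SymCert :=
  ⟨⟨12, 7, 157, 100, 1, [], [], []⟩,
    [(511, 328230722845116160)],
    [(0, 126, 50000000)],
    [twelveSevenSymP14Rows], [twelveSevenSymP14Sqs]⟩

/-- The digest of part 14: `(orbit key, coefficient total)` in increasing key order (computed by cert/mksym.py, verified below). -/
def twelveSevenSymP14D : List (ℕ × ℤ) :=
  [((4223 : ℕ), (50000000 : ℤ)), (12416, 300000000), (12543, 250000000), (28802, 750000000), (28928, 1500000000), (29183, 500000000), 
    (61574, 1000000000), (61698, 3750000000), (61952, 3000000000), (62463, 500000000), (127118, 750000000), (127238, 5000000000), 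
    (127490, 7500000000), (128000, 3000000000), (129023, 250000000), (258206, 300000000), (258238, 50000000), (258318, 3750000000), 
    (258334, 1500000000), (258366, 250000000), (258566, 10000000000), (258574, 7500000000), (258590, 3000000000), (258622, 500000000), 
    (259074, 7500000000), (259078, 10000000000), (259086, 7500000000), (259102, 3000000000), (259134, 500000000), (260096, 1500000000), 
    (260098, 3750000000), (260102, 5000000000), (260110, 3750000000), (260126, 1500000000), (260158, 250000000), (262143, 50000000), 
    (262144, 300000000), (262146, 750000000), (262150, 1000000000), (262158, 750000000), (262174, 300000000), (262206, 50000000), 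
    (520830, -1181630602242418176000), (521278, -8271414215696927232000), (522270, -12407121323545390848000), (524302, -4135707107848463616000), 
    (1045246, -295407650560604544000), (1045630, -3544891806727254528000), (1046590, -8271414215696927232000), (1048606, -4135707107848463616000), 
    (2094078, -32823072284511616000), (2094334, -886222951681813632000), (2094590, -98469216853534848000), (2095230, -3544891806727254528000), 
    (2095358, -886222951681813632000), (2095614, -98469216853534848000), (2097214, -2757138071898975744000), (2097278, -1181630602242418176000), 
    (2097406, -295407650560604544000), (2097662, -32823072284511616000), (16781375, -50000000), (16781823, 51532223486683237120)]

/-- **The digest of part 14 is `twelveSevenSymP14D`** (kernel evaluation of the part's 3636 contributions). -/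
theorem twelveSevenSymP14_digest : twelveSevenSymP14.digest 20 = twelveSevenSymP14D := by
  decide +kernel

end QCert
end HubOnly

end Summit.CriticalPhenomena.PercolationContinuityZ3.Theorems
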